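import Literature.NumberTheory.EllipticCurves.RationalTateModuleLattices
import Literature.NumberTheory.EllipticCurves.PrimaryTorsionGaloisRep
import Literature.NumberTheory.EllipticCurves.BigGaloisRepLocalInputs
import Literature.NumberTheory.IwasawaTheory.PruferPontryaginDual
import Mathlib.RingTheory.TensorProduct.Free
import HarnessLib

/-!
# Telescope line, crux 4 `BSDpOnCellC` — ADAPTER-T: a `ℤ_p`-basis of `T_pE` identifies `(ℚ_p/ℤ_p)ⁿ` with
# `E[p^∞]`, `Γ`-equivariantly for the matrices of `ρ_{E,p}` in that basis

Helper (closes NO registered stub; `--supports stmt-BirchSwinnertonDyer-19034 --as helper`), seat `bsd-idea-12` g42,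
division of labour with x2-p2 g23 (bsd-eis INBOX 09:11:05Z: «ADAPTER-T is yours … target it over `Γ_ℚ`»; g23's #7
`…TelescopeBranchLatticeRestrict` restricts to `Γ_K`, #8 `…CofreeMemberAdapter` is the member-side twin ADAPTER-M).
It is the target-side identification the (fd₀) clause of leaf N1♭ needs after the Galois-lattice fact's (G-fib₀)
(`Literature/…/PNewBranchGaloisLattice`: the `X = 0` fibre of the big lattice is conjugate over `ℚ_p` to
`W.galoisRepTate p` in a `ℤ_p`-basis `b` of `T_pE`): from `b : Module.Basis (Fin n) ℤ_[p] (W.tateModule p)`,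

  `t_b : (Fin n → ℚ_p/ℤ_p) →+ E[p^∞] = PrimaryTorsion (geomPoints W) p`,  `[q] ↦ toPrimary (Σ_i q_i ⊗ b_i)`,

`ℤ_p`-linear, BIJECTIVE, and `t_b (M_σ · v) = σ · t_b v` for `M_σ = LinearMap.toMatrix b b (W.galoisRepTate p σ)`
and every `σ : Γ_F` (`exists_tateAdapter`). Ingredients, all in the tree: Lang's exact sequence
`0 → T_p A → V_p A = ℚ_p ⊗ T_p A →(toPrimary) A[p^∞] → 0` (`RationalTateModuleSequence`: `toPrimary_coe_tmul`,
`toPrimary_eq_zero_iff`, `range_toPrimary_eq_primaryComponent_of_smul_surjective`, `toPrimary_rationalTateRepresentation`;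
`RationalTateModuleLattices`: `toPrimary_padicInt_smul_eq`), divisibility of `E(F̄)` (`exists_nsmul_eq_geomPoints
zsmul_geomPoints_surjective_holds`), Mathlib's `Algebra.TensorProduct.basis` (`1 ⊗ b_i` is a `ℚ_p`-basis of
`ℚ_p ⊗ T_p A`) and `Matrix.toLin_self`. §1 is generic (`A` any abelian group, `b` any `ℤ_p`-basis of `T_p A` indexed by
a finite type); §2 is the curve statement. THEOREMS ONLY; no new definitions, no named fact, no sorry.
BSD is proved for no curve by this file; no summit statement / crux / registered stub is proved.
-/

set_option linter.dupNamespace false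

noncomputable section

open scoped TensorProduct
open Function Field WeierstrassCurve
open Literature.NumberTheory.EllipticCurves Literature.NumberTheory.IwasawaTheory
  Literature.NumberTheory.GaloisRepresentations

namespace Summit.BirchSwinnertonDyer.BirchSwinnertonDyer.Theorems.TelescopeBranchTateAdapter

universe u

/-! ### §1. Coordinates on `V_p A = ℚ_p ⊗ T_p A` from a `ℤ_p`-basis of `T_p A`, and the map to `A[p^∞]` -/

section Generic

variable {A : Type u} [AddCommGroup A] {p : ℕ} [Fact p.Prime] {ι : Type*} [Fintype ι]

/-- `Σ_i y_i ⊗ b_i = Σ_i y_i • (1 ⊗ b_i)`: coordinates in the `ℚ_p`-basis `1 ⊗ b` of `ℚ_p ⊗ T_p A`. -/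
theorem sum_tmul_eq_sum_smul_basis (b : Module.Basis ι ℤ_[p] (TateModule A p)) (y : ι → ℚ_[p]) :
    (∑ i, (y i ⊗ₜ[ℤ_[p]] b i : ℚ_[p] ⊗[ℤ_[p]] TateModule A p)) =
      ∑ i, y i • Algebra.TensorProduct.basis ℚ_[p] b i :=
  Finset.sum_congr rfl fun i _ ↦ (Algebra.TensorProduct.basis_repr_symm_apply' b (y i) i).symm

/-- The coordinate map `y ↦ Σ_i y_i ⊗ b_i` is injective (`1 ⊗ b` is a `ℚ_p`-basis of `ℚ_p ⊗ T_p A`). -/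
theorem eq_of_sum_tmul_eq (b : Module.Basis ι ℤ_[p] (TateModule A p)) {y y' : ι → ℚ_[p]}
    (h : (∑ i, (y i ⊗ₜ[ℤ_[p]] b i : ℚ_[p] ⊗[ℤ_[p]] TateModule A p)) = ∑ i, (y' i ⊗ₜ[ℤ_[p]] b i)) :
    y = y' := by
  rw [sum_tmul_eq_sum_smul_basis, sum_tmul_eq_sum_smul_basis] at h
  have h0 : ∑ i, (y i - y' i) • Algebra.TensorProduct.basis ℚ_[p] b i = 0 := by
    simp_rw [sub_smul, Finset.sum_sub_distrib, h, sub_self]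
  funext i
  exact sub_eq_zero.mp
    (Fintype.linearIndependent_iff.mp (Algebra.TensorProduct.basis ℚ_[p] b).linearIndependent _ h0 i)

/-- Every element of `ℚ_p ⊗ T_p A` is a coordinate sum `Σ_i y_i ⊗ b_i`. -/
theorem exists_eq_sum_tmul (b : Module.Basis ι ℤ_[p] (TateModule A p)) (w : ℚ_[p] ⊗[ℤ_[p]] TateModule A p) :
    ∃ y : ι → ℚ_[p], w = ∑ i, (y i ⊗ₜ[ℤ_[p]] b i) := by
  refine ⟨fun i ↦ (Algebra.TensorProduct.basis ℚ_[p] b).repr w i, ?_⟩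
  rw [sum_tmul_eq_sum_smul_basis]
  exact ((Algebra.TensorProduct.basis ℚ_[p] b).sum_repr w).symm

/-- `1 ⊗ x = Σ_i (b-coordinate of x)_i ⊗ b_i` — the image of `T_p A` in coordinates is `ℤ_pⁿ`. -/
theorem toRational_eq_sum_tmul (b : Module.Basis ι ℤ_[p] (TateModule A p)) (x : TateModule A p) :
    (TateModule.toRational p x : ℚ_[p] ⊗[ℤ_[p]] TateModule A p) =
      ∑ i, (((b.repr x i : ℤ_[p]) : ℚ_[p]) ⊗ₜ[ℤ_[p]] b i) := by
  conv_lhs => rw [← b.sum_repr x]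
  rw [map_sum]
  refine Finset.sum_congr rfl fun i _ ↦ ?_
  rw [TateModule.toRational_apply, ← TensorProduct.smul_tmul, Algebra.smul_def, mul_one,
    PadicInt.algebraMap_apply]

/-- Matrix bookkeeping: `Σ_j q_j ⊗ f(b_j) = Σ_i (Σ_j M_{ij} q_j) ⊗ b_i` for `M = LinearMap.toMatrix b b f`
(`f(b_j) = Σ_i M_{ij} b_i`, `Matrix.toLin_self`). -/
theorem sum_tmul_apply_basis_eq [DecidableEq ι] {T : Type*} [AddCommGroup T] [Module ℤ_[p] T]
    (b : Module.Basis ι ℤ_[p] T) (f : T →ₗ[ℤ_[p]] T) (q : ι → ℚ_[p]) :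
    (∑ j, (q j ⊗ₜ[ℤ_[p]] f (b j) : ℚ_[p] ⊗[ℤ_[p]] T)) =
      ∑ i, ((∑ j, ((LinearMap.toMatrix b b f i j : ℤ_[p]) : ℚ_[p]) * q j) ⊗ₜ[ℤ_[p]] b i) := by
  have hf : ∀ j, f (b j) = ∑ i, LinearMap.toMatrix b b f i j • b i := fun j ↦ by
    conv_lhs => rw [← Matrix.toLin_toMatrix b b f]
    rw [Matrix.toLin_self]
  simp_rw [hf, TensorProduct.tmul_sum, TensorProduct.sum_tmul]
  rw [Finset.sum_comm]
  refine Finset.sum_congr rfl fun i _ ↦ Finset.sum_congr rfl fun j _ ↦ ?_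
  rw [← TensorProduct.smul_tmul, Algebra.smul_def, PadicInt.algebraMap_apply]

/-- `p^s` kills `toPrimary v` when `v = p^{-s} • (1 ⊗ b')` (the level of a normal form). -/
theorem pow_smul_toPrimary_eq_zero {v : RationalTateModule A p} {s : ℕ} {b' : TateModule A p}
    (hv : v = ((p : ℚ_[p]) ^ s)⁻¹ • TateModule.toRational p b') :
    p ^ s • RationalTateModule.toPrimary A p v = 0 := by
  have hp0 : ((p : ℚ_[p]) ^ s) ≠ 0 := pow_ne_zero _ (Nat.cast_ne_zero.mpr (Fact.out : p.Prime).ne_zero)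
  rw [← RationalTateModule.toPrimary_pow_smul, hv, ← algebraMap_smul ℚ_[p] ((p : ℤ_[p]) ^ s), map_pow,
    map_natCast, smul_smul, mul_inv_cancel₀ hp0, one_smul, RationalTateModule.toPrimary_toRational]

/-- **The map `(ι → ℚ_p/ℤ_p) → A[p^∞]` of a `ℤ_p`-basis `b` of `T_p A`**: a `ℤ_p`-LINEAR `t_b` with
`t_b ([q_i]_i) = toPrimary (Σ_i q_i ⊗ b_i)` (well defined because `toPrimary` kills `1 ⊗ T_p A ∋ Σ_i c_i ⊗ b_i`
for `c ∈ ℤ_pⁿ`; `ℤ_p`-linear because `toPrimary (c • v) = (c mod p^s) • toPrimary v` and `A[p^∞]` carries the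
`ℤ_p`-structure `c • a = (c mod p^k) • a`). -/
theorem exists_linearMap_apply_mk (b : Module.Basis ι ℤ_[p] (TateModule A p)) :
    ∃ t : (ι → QpModZp p) →ₗ[ℤ_[p]] PrimaryTorsion A p,
      ∀ q : ι → ℚ_[p], ((t fun i ↦ QpModZp.mk p (q i)) : A) =
        RationalTateModule.toPrimary A p
          ((∑ i, (q i ⊗ₜ[ℤ_[p]] b i : ℚ_[p] ⊗[ℤ_[p]] TateModule A p)) : RationalTateModule A p) := by
  classical
  -- the value homomorphism `A[p^∞] → A`
  let valHom : PrimaryTorsion A p →+ A :=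
    { toFun := PrimaryTorsion.val, map_zero' := PrimaryTorsion.val_zero, map_add' := PrimaryTorsion.val_add }
  have hvalHom : ∀ a : PrimaryTorsion A p, valHom a = (a : A) := fun _ ↦ rfl
  -- the `i`-th coordinate map `ℚ_p → A[p^∞]`, `y ↦ toPrimary (y ⊗ b_i)`
  let g : ι → ℚ_[p] → PrimaryTorsion A p := fun i y ↦
    ⟨RationalTateModule.toPrimary A p ((y ⊗ₜ[ℤ_[p]] b i : ℚ_[p] ⊗[ℤ_[p]] TateModule A p) : RationalTateModule A p),
      RationalTateModule.toPrimary_mem_primaryComponent p _⟩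
  have hg : ∀ i y, ((g i y : PrimaryTorsion A p) : A) =
      RationalTateModule.toPrimary A p ((y ⊗ₜ[ℤ_[p]] b i : ℚ_[p] ⊗[ℤ_[p]] TateModule A p) :
        RationalTateModule A p) := fun _ _ ↦ rfl
  have hg_add : ∀ i y y', g i (y + y') = g i y + g i y' := fun i y y' ↦ PrimaryTorsion.ext (by
    rw [PrimaryTorsion.val_add, hg, hg, hg, ← map_add]
    exact congrArg _ (TensorProduct.add_tmul y y' (b i)))
  have hg_smul : ∀ (i) (c : ℤ_[p]) (y : ℚ_[p]), g i (c • y) = c • g i y := fun i c y ↦ by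
    obtain ⟨s, b', hv⟩ := RationalTateModule.exists_eq_inv_pow_smul_toRational p
      ((y ⊗ₜ[ℤ_[p]] b i : ℚ_[p] ⊗[ℤ_[p]] TateModule A p) : RationalTateModule A p)
    have hk : p ^ s • ((g i y : PrimaryTorsion A p) : A) = 0 := by
      rw [hg]; exact pow_smul_toPrimary_eq_zero hv
    apply PrimaryTorsion.ext
    rw [PrimaryTorsion.val_smul_eq_zpT c (g i y) hk, IwasawaDual.zpT_def, hg, hg,
      ← RationalTateModule.toPrimary_padicInt_smul_eq p c hv]
    exact congrArg _ (TensorProduct.smul_tmul' c y (b i)).symm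
  let f : ι → (ℚ_[p] →ₗ[ℤ_[p]] PrimaryTorsion A p) := fun i ↦
    { toFun := g i, map_add' := hg_add i, map_smul' := hg_smul i }
  have hf : ∀ i y, f i y = g i y := fun _ _ ↦ rfl
  -- `ℤ_p ⊂ ℚ_p` is killed: descend to `ℚ_p/ℤ_p`
  have hker : ∀ i, (1 : Submodule ℤ_[p] ℚ_[p]) ≤ LinearMap.ker (f i) := fun i y hy ↦ by
    rw [Submodule.mem_one] at hy
    obtain ⟨z, rfl⟩ := hy
    rw [LinearMap.mem_ker, hf]
    apply PrimaryTorsion.ext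
    rw [hg, PrimaryTorsion.val_zero, PadicInt.algebraMap_apply]
    exact RationalTateModule.toPrimary_coe_tmul p z (b i)
  let t₁ : ι → (QpModZp p →ₗ[ℤ_[p]] PrimaryTorsion A p) := fun i ↦ (1 : Submodule ℤ_[p] ℚ_[p]).liftQ (f i) (hker i)
  have ht₁ : ∀ i (y : ℚ_[p]), t₁ i (QpModZp.mk p y) = g i y := fun i y ↦ by
    rw [← hf]; exact Submodule.liftQ_apply _ _ y
  refine ⟨∑ i, (t₁ i).comp (LinearMap.proj i), fun q ↦ ?_⟩
  rw [LinearMap.sum_apply, ← hvalHom, map_sum, map_sum]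
  refine Finset.sum_congr rfl fun i _ ↦ ?_
  rw [LinearMap.comp_apply, LinearMap.proj_apply, ht₁, hvalHom, hg]

end Generic

/-! ### §2. The curve: `t_b : (ℚ_p/ℤ_p)ⁿ ≅ E[p^∞]`, `ℤ_p`-linear, bijective, `Γ_F`-equivariant in the basis `b` -/

/-- **ADAPTER-T.** For a Weierstrass curve `W` over a field `F` (elliptic), a prime `p` and a `ℤ_p`-basis `b` of the
Tate module `T_pE = W.tateModule p` indexed by `Fin n`: there is an additive `t : (Fin n → ℚ_p/ℤ_p) →+ E[p^∞]`
(`E[p^∞] = PrimaryTorsion (geomPoints W) p`) with `t([q]) = toPrimary (Σ_i q_i ⊗ b_i)`, which is `ℤ_p`-linear,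
injective (`ker toPrimary = 1 ⊗ T_pE` and `1 ⊗ b` is a `ℚ_p`-basis), surjective (`E(F̄)` is divisible, so
`toPrimary` is onto `E[p^∞]`), and intertwines the matrices `M_σ = LinearMap.toMatrix b b (ρ_{E,p}(σ))` acting on
`(ℚ_p/ℤ_p)ⁿ` by `v ↦ (Σ_j M_σ i j • v j)_i` with the Galois action `W.primaryTorsionGaloisRep p σ` on `E[p^∞]`, for every
`σ : Γ_F`. With (G-fib₀) of the Galois-lattice fact (rational conjugacy of the `X = 0` fibre to `[ρ_{E,p}]_b`), the
integral intertwiner of `…TelescopeBranchIntegralIntertwiner` and x2-p2's `exists_isogeny_of_intertwiner`, this gives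
the (fd₀) clause of N1♭ over `Γ_ℚ` (then `Γ_K` by x2-p2 #7). -/
theorem exists_tateAdapter {F : Type u} [Field F] (W : WeierstrassCurve F) [W.IsElliptic] (p : ℕ) [Fact p.Prime]
    {n : ℕ} (b : Module.Basis (Fin n) ℤ_[p] (W.tateModule p)) :
    ∃ t : (Fin n → QpModZp p) →+ PrimaryTorsion (geomPoints W) p,
      (∀ q : Fin n → ℚ_[p], ((t fun i ↦ QpModZp.mk p (q i)) : geomPoints W) =
        RationalTateModule.toPrimary (geomPoints W) p
          ((∑ i, (q i ⊗ₜ[ℤ_[p]] b i : ℚ_[p] ⊗[ℤ_[p]] W.tateModule p)) : W.rationalTateModule p)) ∧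
      (∀ (c : ℤ_[p]) (v : Fin n → QpModZp p), t (c • v) = c • t v) ∧
      Injective t ∧ Surjective t ∧
      ∀ (σ : absoluteGaloisGroup F) (v : Fin n → QpModZp p),
        t (fun i ↦ ∑ j, (LinearMap.toMatrix b b (W.galoisRepTate p σ)) i j • v j) =
          W.primaryTorsionGaloisRep p σ (t v) := by
  classical
  obtain ⟨t, ht⟩ := exists_linearMap_apply_mk (A := geomPoints W) b
  -- every `v : (ℚ_p/ℤ_p)ⁿ` lifts to `ℚ_pⁿ`
  have hlift : ∀ v : Fin n → QpModZp p, ∃ q : Fin n → ℚ_[p], (fun i ↦ QpModZp.mk p (q i)) = v := fun v ↦ by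
    choose q hq using fun i ↦ Submodule.Quotient.mk_surjective (1 : Submodule ℤ_[p] ℚ_[p]) (v i)
    exact ⟨q, funext hq⟩
  refine ⟨t.toAddMonoidHom, fun q ↦ ?_, fun c v ↦ ?_, ?_, ?_, fun σ v ↦ ?_⟩
  · rw [LinearMap.toAddMonoidHom_coe, ht]
  · rw [LinearMap.toAddMonoidHom_coe, map_smul]
  · -- injective: `toPrimary (Σ q_i ⊗ b_i) = 0` forces `Σ q_i ⊗ b_i ∈ 1 ⊗ T_pE`, i.e. `q ∈ ℤ_pⁿ`
    intro v v' hvv'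
    rw [← sub_eq_zero] at hvv' ⊢
    rw [← map_sub] at hvv'
    obtain ⟨q, hq⟩ := hlift (v - v')
    rw [← hq] at hvv' ⊢
    have h0 : RationalTateModule.toPrimary (geomPoints W) p
        ((∑ i, (q i ⊗ₜ[ℤ_[p]] b i : ℚ_[p] ⊗[ℤ_[p]] W.tateModule p)) : W.rationalTateModule p) = 0 := by
      rw [← ht, ← LinearMap.toAddMonoidHom_coe, hvv', PrimaryTorsion.val_zero]
    obtain ⟨x, hx⟩ := (RationalTateModule.toPrimary_eq_zero_iff p _).mp h0
    have hx' : (∑ i, ((((b.repr x i : ℤ_[p]) : ℚ_[p]) ⊗ₜ[ℤ_[p]] b i) : ℚ_[p] ⊗[ℤ_[p]] W.tateModule p)) =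
        ∑ i, (q i ⊗ₜ[ℤ_[p]] b i) := by
      rw [← toRational_eq_sum_tmul b x]; exact hx
    have hq' : (fun i ↦ ((b.repr x i : ℤ_[p]) : ℚ_[p])) = q := eq_of_sum_tmul_eq b hx'
    funext i
    rw [← hq']
    exact (QpModZp.mk_eq_zero_iff p _).mpr (b.repr x i).2
  · -- surjective: `E(F̄)` is divisible, so `toPrimary` is onto `E[p^∞]`, and `ℚ_p ⊗ T_pE = {Σ y_i ⊗ b_i}`
    intro a
    have hs : Surjective fun P : geomPoints W ↦ p • P := fun P ↦
      W.exists_nsmul_eq_geomPoints W.zsmul_geomPoints_surjective_holds (Fact.out : p.Prime).ne_zero P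
    have ha : (a : geomPoints W) ∈ (RationalTateModule.toPrimary (geomPoints W) p).range := by
      rw [RationalTateModule.range_toPrimary_eq_primaryComponent_of_smul_surjective p hs]; exact a.2
    obtain ⟨w, hw⟩ := ha
    obtain ⟨y, hy⟩ := exists_eq_sum_tmul b w
    refine ⟨fun i ↦ QpModZp.mk p (y i), PrimaryTorsion.ext ?_⟩
    rw [LinearMap.toAddMonoidHom_coe, ht, ← hw]
    exact congrArg _ hy.symm
  · -- equivariance: `Σ_j q_j ⊗ σ b_j = Σ_i (M_σ q)_i ⊗ b_i` and `toPrimary ∘ ρ_V(σ) = σ ∘ toPrimary`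
    obtain ⟨q, rfl⟩ := hlift v
    have hM : (fun i ↦ ∑ j, (LinearMap.toMatrix b b (W.galoisRepTate p σ)) i j • QpModZp.mk p (q j)) =
        fun i ↦ QpModZp.mk p (∑ j, ((LinearMap.toMatrix b b (W.galoisRepTate p σ) i j : ℤ_[p]) : ℚ_[p]) * q j) := by
      funext i
      simp_rw [QpModZp.smul_mk]
      exact (map_sum (Submodule.mkQ (1 : Submodule ℤ_[p] ℚ_[p])) _ _).symm
    rw [hM]
    apply PrimaryTorsion.ext
    -- `ρ_V(σ) (Σ_j q_j ⊗ b_j) = Σ_i (Σ_j M_{ij} q_j) ⊗ b_i`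
    have hρ : rationalTateRepresentation (absoluteGaloisGroup F) (geomPoints W) p σ
          ((∑ j, (q j ⊗ₜ[ℤ_[p]] b j : ℚ_[p] ⊗[ℤ_[p]] W.tateModule p)) : W.rationalTateModule p) =
        ((∑ i, ((∑ j, ((LinearMap.toMatrix b b (W.galoisRepTate p σ) i j : ℤ_[p]) : ℚ_[p]) * q j) ⊗ₜ[ℤ_[p]] b i) :
            ℚ_[p] ⊗[ℤ_[p]] W.tateModule p) : W.rationalTateModule p) := by
      rw [map_sum, ← sum_tmul_apply_basis_eq b (W.galoisRepTate p σ) q]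
      exact Finset.sum_congr rfl fun j _ ↦ rationalTateRepresentation_apply_tmul σ (q j) (b j)
    calc ((t.toAddMonoidHom fun i ↦ QpModZp.mk p
            (∑ j, ((LinearMap.toMatrix b b (W.galoisRepTate p σ) i j : ℤ_[p]) : ℚ_[p]) * q j) :
              PrimaryTorsion (geomPoints W) p) : geomPoints W)
          = RationalTateModule.toPrimary (geomPoints W) p
              ((∑ i, ((∑ j, ((LinearMap.toMatrix b b (W.galoisRepTate p σ) i j : ℤ_[p]) : ℚ_[p]) * q j) ⊗ₜ[ℤ_[p]]
                  b i) : ℚ_[p] ⊗[ℤ_[p]] W.tateModule p) : W.rationalTateModule p) := ht _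
      _ = σ • RationalTateModule.toPrimary (geomPoints W) p
              ((∑ j, (q j ⊗ₜ[ℤ_[p]] b j : ℚ_[p] ⊗[ℤ_[p]] W.tateModule p)) : W.rationalTateModule p) := by
            rw [← hρ, RationalTateModule.toPrimary_rationalTateRepresentation]
      _ = _ := by
            rw [WeierstrassCurve.val_primaryTorsionGaloisRep_apply]
            exact congrArg _ (ht q).symm

end Summit.BirchSwinnertonDyer.BirchSwinnertonDyer.Theorems.TelescopeBranchTateAdapter

end
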